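import Literature.AlgebraicGeometry.Motives.AbelianVarietyKummerPairing
import Literature.AlgebraicGeometry.Motives.AbelianVarietyWeilDivisor
import HarnessLib

/-!
# The level-`N` Weil pairing `ē_N^Θ(P, Q) = e_N(P, t_Q^* Θ - Θ)` on `A[N](K)` (Lang VII §2; Milne §16)

Let `A` be an abelian variety over a field `K`, `Θ` a Cartier divisor on `A` and `N` a natural
number with `[N]_A` dominant. For `N`-torsion points `P, Q ∈ A[N](K)` the **level-`N` Weil pairing
of `Θ`** is the Kummer pairing (`Motives/AbelianVarietyKummerPairing`, Lang, *Abelian Varieties*,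
VII §2, Prop. 3) of `P` with the divisor `D_Q = t_Q^* Θ - Θ` (`Motives/AbelianVarietyWeilDivisor`),
defined because `[N]^* D_Q ∼ 0` (`pullback_zsmul_weilDiv_linEquiv_zero`):

  `ē_N^Θ(P, Q) := e_N(P, D_Q) = t_P^♯ g_Q / g_Q ∈ μ_N(K)`, `[N]^* D_Q + div g_Q = 0`.

This is Milne, *Abelian varieties* (1986), §16: `ē_m^𝓛(a, a') = ē_m(a, φ_𝓛(a'))` with
`ē_m(a, [D]) = g / g ∘ t_a`, `m_A⁻¹ D = (g)` (p. 132) — up to the sign convention `a ↦ -a` — and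
Lang, *Abelian Varieties*, VII §2, `e_n(a, Cl(X_b - X))`; Mumford, *Abelian Varieties*, §20,
`e_n(a, φ_L(b))`. Proved here (no named facts, D-0026):

* `weilPairingLevel_mul_left/right` — **bimultiplicativity** (Lang VII §2, Prop. 3 and the theorem
  of the square `D_{QQ'} ∼ D_Q + D_{Q'}`, `weilDiv_mul_linEquiv`);
* `weilPairingLevel_pow_card_eq_one` — values in `μ_N(K)`;
* `translFF_weilFn` — the printed defining relation `g_Q ∘ t_P = ē(P, Q) · g_Q`;
* `weilPairingLevel_level_mul` — **compatibility in the level** (Lang VII §2, Prop. 5, first form: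
  "`e_{mn}(a, ξ) = e_n(ma, ξ)` for `nξ = 0`, `mna = 0`"; Milne §16, Lemma 16.1): `[m]^♯ g_Q`
  trivializes `[mn]^* D_Q`, and `t_a^♯ [m]^♯ = [m]^♯ t_{aᵐ}^♯`;
* `pullback_translation_linEquiv_of_forall_weilPairingLevel_eq_one` — **non-degeneracy in `Q`
  modulo `K(Θ)`** (Lang VII §2, Prop. 4): if `ē_N^Θ(P, Q) = 1` for all `P ∈ A[N](K)` then
  `t_Q^* Θ ∼ Θ`, i.e. `Q ∈ K(Θ)` (hypotheses of the Kummer theory of `[N]`: `0 < N`, `[N]` flat and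
  surjective, `[K(A) : [N]^♯K(A)] = #A[N](K) < ∞`).

Skew-symmetry (Lang VII §2, Prop. 7 / Thm. 5) and the finiteness of `K(Θ)` for ample `Θ` are
treated separately. Towards the named fact
`Literature.NumberTheory.DiophantineGeometry.weilPairing_rationalTateModule`.

## References

* [Lang1983AbelianVarieties] S. Lang, *Abelian Varieties*, Ch. VII §2, Props. 3–5 (PDF pp. 138–140).
* [Milne1986AbelianVarieties] J. S. Milne, *Abelian varieties*, in Cornell–Silverman (1986), §16,
  p. 132 and Lemma 16.1.
* [MumfordAV1970] D. Mumford, *Abelian Varieties* (1970), §20 (pp. 183–185).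
-/

universe u

open CategoryTheory CategoryTheory.Limits AlgebraicGeometry MonoidalCategory CartesianMonoidalCategory

noncomputable section

namespace Literature.AlgebraicGeometry.Motives

open scoped MonObj
open RatFn

namespace AbelianVariety

variable {K : Type u} [Field K] (A : AbelianVariety K)

/-! ### Torsion points: inclusions and powers -/

/-- An `N`-torsion point is `M N`-torsion. [folklore] -/
def torsionPointsOfDvd {N : ℕ} (M : ℕ) (Q : A.torsionPoints K N) : A.torsionPoints K ((M * N : ℕ) : ℤ) :=
  ⟨Q.1, by
    rw [mem_torsionPoints_iff, zpow_natCast, mul_comm, pow_mul, coe_torsionPoints_pow_eq_one, one_pow]⟩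

/-- Unfolding `torsionPointsOfDvd`. [folklore] -/
@[simp] theorem coe_torsionPointsOfDvd {N : ℕ} (M : ℕ) (Q : A.torsionPoints K N) :
    (A.torsionPointsOfDvd M Q : A.Points K) = Q := rfl

/-- The `M`-th power of an `M N`-torsion point is `N`-torsion. [folklore] -/
def torsionPointsPow {N : ℕ} (M : ℕ) (P : A.torsionPoints K ((M * N : ℕ) : ℤ)) : A.torsionPoints K N :=
  ⟨P.1 ^ M, by
    rw [mem_torsionPoints_iff, zpow_natCast, ← pow_mul]
    exact coe_torsionPoints_pow_eq_one P⟩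

/-- Unfolding `torsionPointsPow`. [folklore] -/
@[simp] theorem coe_torsionPointsPow {N : ℕ} (M : ℕ) (P : A.torsionPoints K ((M * N : ℕ) : ℤ)) :
    (A.torsionPointsPow M P : A.Points K) = P ^ M := rfl

/-! ### The level-`N` Weil pairing -/

section Level

variable {N : ℕ} [IsDominant (Hom.toSchemeHom ((N : ℤ) • 𝟙 A))]

/-- `[N]^* D_Q` has a trivializer for `Q ∈ A[N](K)`. [folklore] -/
theorem exists_isTrivializer_weilDiv (Θ : CartierDivisor A.X.left) (Q : A.torsionPoints K N) :
    ∃ h, A.IsTrivializer (n := N) (A.weilDiv Θ Q.1) h :=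
  A.exists_isTrivializer (A.pullback_zsmul_weilDiv_linEquiv_zero Θ (coe_torsionPoints_pow_eq_one Q))

/-- **A Weil function `g_Q`** for `Θ` at the `N`-torsion point `Q`: a rational function with
`[N]^* (t_Q^* Θ - Θ) + div g_Q = 0` (Milne §16, p. 132: "`m_A⁻¹ D = (g)`"; Lang VII §2, Prop. 2:
"`(nδ)⁻¹(X) = (ω)`"), chosen once and for all. [cite: Milne1986AbelianVarieties, §16 (p. 132)] -/
def weilFn (Θ : CartierDivisor A.X.left) (Q : A.torsionPoints K N) : A.X.left.functionField :=
  Classical.choose (A.exists_isTrivializer_weilDiv Θ Q)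

/-- `g_Q` trivializes `[N]^* D_Q`. [folklore] -/
theorem isTrivializer_weilFn (Θ : CartierDivisor A.X.left) (Q : A.torsionPoints K N) :
    A.IsTrivializer (n := N) (A.weilDiv Θ Q.1) (A.weilFn Θ Q) :=
  Classical.choose_spec (A.exists_isTrivializer_weilDiv Θ Q)

/-- **The level-`N` Weil pairing `ē_N^Θ(P, Q) = e_N(P, t_Q^* Θ - Θ) ∈ K`** of two `N`-torsion
points (Milne 1986, §16: `ē_m^𝓛(a, a') = ē_m(a, φ_𝓛 a')`, `ē_m(a, [D]) = g/g∘t_a`; Lang VII §2;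
Mumford §20): the constant `t_P^♯ g_Q / g_Q`. [cite: Milne1986AbelianVarieties, §16 (p. 132, ē_m and ē_m^λ)] -/
def weilPairingLevel (Θ : CartierDivisor A.X.left) (P Q : A.torsionPoints K N) : K :=
  kummerConst (A.isTrivializer_weilFn Θ Q) P

variable {A}

/-- `ē_N^Θ(P, Q)` may be computed with ANY trivializer of `[N]^* D_Q`. [folklore] -/
theorem weilPairingLevel_eq_kummerConst {Θ : CartierDivisor A.X.left} {Q : A.torsionPoints K N}
    {h : A.X.left.functionField} (hh : A.IsTrivializer (n := N) (A.weilDiv Θ Q.1) h)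
    (P : A.torsionPoints K N) : A.weilPairingLevel Θ P Q = kummerConst hh P :=
  kummerConst_eq_of_isTrivializer _ hh P

/-- `ē_N^Θ(P, Q)` may be computed on ANY divisor `E ∼ D_Q` with any trivializer of `[N]^* E`.
[folklore] -/
theorem weilPairingLevel_eq_kummerConst_of_linEquiv {Θ : CartierDivisor A.X.left}
    {Q : A.torsionPoints K N} {E : CartierDivisor A.X.left} {h : A.X.left.functionField}
    (hh : A.IsTrivializer (n := N) E h) (H : (A.weilDiv Θ Q.1).LinEquiv E)
    (P : A.torsionPoints K N) : A.weilPairingLevel Θ P Q = kummerConst hh P :=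
  kummerConst_eq_of_linEquiv _ hh H P

/-- **`g_Q ∘ t_P = ē(P, Q) · g_Q`** — the printed defining relation (Lang VII §2, Prop. 3:
"`ω(u + a) = e_n(a, X) ω(u)`"; Milne §16: "`ē_m(a, a') = g / g ∘ t_a`" up to `a ↦ -a`).
[cite: Lang1983AbelianVarieties, Ch. VII §2 Prop. 3] -/
theorem translFF_weilFn (Θ : CartierDivisor A.X.left) (P Q : A.torsionPoints K N) :
    A.translFF P.1 (A.weilFn Θ Q) =
      algebraMap K A.X.left.functionField (A.weilPairingLevel Θ P Q) * A.weilFn Θ Q :=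
  translFF_eq_kummerConst_smul _ P

/-- `ē_N^Θ(P, Q) ≠ 0`. [folklore] -/
theorem weilPairingLevel_ne_zero (Θ : CartierDivisor A.X.left) (P Q : A.torsionPoints K N) :
    A.weilPairingLevel Θ P Q ≠ 0 :=
  kummerConst_ne_zero _ P

/-- **Values in `μ_N`**: `ē_N^Θ(P, Q) ^ N = 1` (Milne §16: "its `m`-th power is one").
[cite: Milne1986AbelianVarieties, §16 (p. 132)] -/
theorem weilPairingLevel_pow_card_eq_one (Θ : CartierDivisor A.X.left)
    (P Q : A.torsionPoints K N) : A.weilPairingLevel Θ P Q ^ N = 1 :=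
  kummerConst_pow_eq_one _ P

/-- **Multiplicative in `P`** (Lang VII §2, Prop. 3). [cite: Lang1983AbelianVarieties, Ch. VII §2 Prop. 3] -/
theorem weilPairingLevel_mul_left (Θ : CartierDivisor A.X.left) (P P' Q : A.torsionPoints K N) :
    A.weilPairingLevel Θ (P * P') Q = A.weilPairingLevel Θ P Q * A.weilPairingLevel Θ P' Q :=
  kummerConst_mul _ P P'

/-- `ē(1, Q) = 1`. [folklore] -/
theorem weilPairingLevel_one_left (Θ : CartierDivisor A.X.left) (Q : A.torsionPoints K N) :
    A.weilPairingLevel Θ 1 Q = 1 :=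
  kummerConst_one _

/-- `ē(Pᵐ, Q) = ē(P, Q)ᵐ`. [folklore] -/
theorem weilPairingLevel_pow_left (Θ : CartierDivisor A.X.left) (P Q : A.torsionPoints K N)
    (m : ℕ) : A.weilPairingLevel Θ (P ^ m) Q = A.weilPairingLevel Θ P Q ^ m :=
  kummerConst_pow _ P m

/-- **Multiplicative in `Q`** — `D_{QQ'} ∼ D_Q + D_{Q'}` (the theorem of the square) and the
additivity of the Kummer pairing in the divisor (Lang VII §2, Prop. 3: "`(a, ξ) ↦ e_n(a, ξ)` is a
bilinear map"). [cite: Lang1983AbelianVarieties, Ch. VII §2 Prop. 3] -/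
theorem weilPairingLevel_mul_right (Θ : CartierDivisor A.X.left) (P Q Q' : A.torsionPoints K N) :
    A.weilPairingLevel Θ P (Q * Q') = A.weilPairingLevel Θ P Q * A.weilPairingLevel Θ P Q' :=
  kummerConst_eq_mul_of_linEquiv_add _ (A.isTrivializer_weilFn Θ Q) (A.isTrivializer_weilFn Θ Q')
    (A.weilDiv_mul_linEquiv Θ Q.1 Q'.1) P

/-- `ē(P, 1) = 1` (`D_1 ∼ 0`). [folklore] -/
theorem weilPairingLevel_one_right (Θ : CartierDivisor A.X.left) (P : A.torsionPoints K N) :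
    A.weilPairingLevel Θ P 1 = 1 :=
  kummerConst_eq_one_of_linEquiv_zero _ (A.weilDiv_one_linEquiv_zero Θ) P

/-- **The pairing as a character in `Q`** for fixed `P`. [folklore] -/
def weilPairingLevelRightHom (Θ : CartierDivisor A.X.left) (P : A.torsionPoints K N) :
    A.torsionPoints K N →* Kˣ where
  toFun Q := Units.mk0 (A.weilPairingLevel Θ P Q) (weilPairingLevel_ne_zero Θ P Q)
  map_one' := Units.ext (weilPairingLevel_one_right Θ P)
  map_mul' Q Q' := Units.ext (weilPairingLevel_mul_right Θ P Q Q')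

/-- Unfolding `weilPairingLevelRightHom`. [folklore] -/
@[simp] theorem val_weilPairingLevelRightHom_apply (Θ : CartierDivisor A.X.left)
    (P Q : A.torsionPoints K N) :
    (weilPairingLevelRightHom Θ P Q : K) = A.weilPairingLevel Θ P Q := rfl

/-- `ē(P, Qᵐ) = ē(P, Q)ᵐ`. [folklore] -/
theorem weilPairingLevel_pow_right (Θ : CartierDivisor A.X.left) (P Q : A.torsionPoints K N)
    (m : ℕ) : A.weilPairingLevel Θ P (Q ^ m) = A.weilPairingLevel Θ P Q ^ m := by
  rw [← val_weilPairingLevelRightHom_apply, map_pow, Units.val_pow_eq_pow_val,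
    val_weilPairingLevelRightHom_apply]

/-- `ē(P, Q⁻¹) = ē(P, Q)⁻¹`. [folklore] -/
theorem weilPairingLevel_inv_right (Θ : CartierDivisor A.X.left) (P Q : A.torsionPoints K N) :
    A.weilPairingLevel Θ P Q⁻¹ = (A.weilPairingLevel Θ P Q)⁻¹ := by
  rw [← val_weilPairingLevelRightHom_apply, map_inv, Units.val_inv_eq_inv_val,
    val_weilPairingLevelRightHom_apply]

/-- `ē(P⁻¹, Q) = ē(P, Q)⁻¹`. [folklore] -/
theorem weilPairingLevel_inv_left (Θ : CartierDivisor A.X.left) (P Q : A.torsionPoints K N) :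
    A.weilPairingLevel Θ P⁻¹ Q = (A.weilPairingLevel Θ P Q)⁻¹ := by
  rw [weilPairingLevel, weilPairingLevel, ← val_kummerConstHom_apply, map_inv,
    Units.val_inv_eq_inv_val, val_kummerConstHom_apply]

/-! ### Non-degeneracy in `Q` modulo `K(Θ)` (Lang VII §2, Prop. 4) -/

/-- **If `ē_N^Θ(P, Q) = 1` for all `P ∈ A[N](K)` then `t_Q^* Θ ∼ Θ`**, i.e. `Q ∈ K(Θ)` — Lang,
*Abelian Varieties*, VII §2, Prop. 4 ("If `e_n(a, ξ) = 1` for all `a ∈ g_n` and `ξ` fixed, then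
`ξ = 0`") applied to `ξ = Cl(D_Q)`: `D_Q ∼ 0` (`linEquiv_zero_of_forall_kummerConst_eq_one`, the
Kummer theory of `[N]`; hypotheses `0 < N`, `[N]` flat and surjective,
`[K(A) : [N]^♯K(A)] = #A[N](K) < ∞`). [cite: Lang1983AbelianVarieties, Ch. VII §2 Prop. 4] -/
theorem weilDiv_linEquiv_zero_of_forall_weilPairingLevel_eq_one (hN : 0 < N)
    [Flat (Hom.toSchemeHom ((N : ℤ) • 𝟙 A))] [Surjective (Hom.toSchemeHom ((N : ℤ) • 𝟙 A))]
    [Finite (A.torsionPoints K N)]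
    (hdeg : Module.finrank A.X.left.functionField
      (FunctionFieldOver (Hom.toSchemeHom ((N : ℤ) • 𝟙 A))) = Nat.card (A.torsionPoints K N))
    (Θ : CartierDivisor A.X.left) (Q : A.torsionPoints K N)
    (h1 : ∀ P : A.torsionPoints K N, A.weilPairingLevel Θ P Q = 1) : (A.weilDiv Θ Q.1).LinEquiv 0 :=
  linEquiv_zero_of_forall_kummerConst_eq_one hN hdeg (A.isTrivializer_weilFn Θ Q) h1

/-- The same, as **`t_Q^* Θ ∼ Θ`** (`Q ∈ K(Θ)`). [cite: Lang1983AbelianVarieties, Ch. VII §2 Prop. 4] -/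
theorem pullback_translation_linEquiv_of_forall_weilPairingLevel_eq_one (hN : 0 < N)
    [Flat (Hom.toSchemeHom ((N : ℤ) • 𝟙 A))] [Surjective (Hom.toSchemeHom ((N : ℤ) • 𝟙 A))]
    [Finite (A.torsionPoints K N)]
    (hdeg : Module.finrank A.X.left.functionField
      (FunctionFieldOver (Hom.toSchemeHom ((N : ℤ) • 𝟙 A))) = Nat.card (A.torsionPoints K N))
    (Θ : CartierDivisor A.X.left) (Q : A.torsionPoints K N)
    (h1 : ∀ P : A.torsionPoints K N, A.weilPairingLevel Θ P Q = 1) :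
    (Θ.pullback (A.translation Q.1).left).LinEquiv Θ :=
  CartierDivisor.LinEquiv.of_add_neg
    (weilDiv_linEquiv_zero_of_forall_weilPairingLevel_eq_one hN hdeg Θ Q h1)

end Level

/-! ### Compatibility in the level (Lang VII §2, Prop. 5; Milne §16, Lemma 16.1) -/

section LevelChange

variable {M N : ℕ} [IsDominant (Hom.toSchemeHom ((N : ℤ) • 𝟙 A))]
  [IsDominant (Hom.toSchemeHom ((M : ℤ) • 𝟙 A))]
  [IsDominant (Hom.toSchemeHom (((M * N : ℕ) : ℤ) • 𝟙 A))]

omit [IsDominant (Hom.toSchemeHom ((N : ℤ) • 𝟙 A))] [IsDominant (Hom.toSchemeHom ((M : ℤ) • 𝟙 A))]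
  [IsDominant (Hom.toSchemeHom (((M * N : ℕ) : ℤ) • 𝟙 A))] in
/-- `[M N] = [M] ≫ [N]` on the underlying schemes. [folklore] -/
theorem toSchemeHom_mul_zsmul_id :
    Hom.toSchemeHom (((M * N : ℕ) : ℤ) • 𝟙 A) =
      Hom.toSchemeHom ((M : ℤ) • 𝟙 A) ≫ Hom.toSchemeHom ((N : ℤ) • 𝟙 A) := by
  have h : (((M * N : ℕ) : ℤ) • 𝟙 A) = ((M : ℤ) • 𝟙 A) ≫ ((N : ℤ) • 𝟙 A) := by
    rw [Preadditive.zsmul_comp, Preadditive.comp_zsmul, Category.comp_id, smul_smul, Nat.cast_mul,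
      mul_comm]
  change (((M * N : ℕ) : ℤ) • 𝟙 A).hom.hom.hom.left = _
  rw [h, comp_hom]
  rfl

variable {A} in
/-- **Change of level for trivializers**: if `g` trivializes `[N]^* E` then `[M]^♯ g` trivializes
`[M N]^* E = [M]^* [N]^* E` (Lang VII §2, proof of Prop. 5: "`ω'(u) = ω(mu)`").
[cite: Lang1983AbelianVarieties, Ch. VII §2 Prop. 5 (proof)] -/
theorem IsTrivializer.level_mul {E : CartierDivisor A.X.left} {g : A.X.left.functionField}
    (hg : A.IsTrivializer (n := N) E g) :
    A.IsTrivializer (n := M * N) E (functionFieldMap (Hom.toSchemeHom ((M : ℤ) • 𝟙 A)) g) := by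
  refine ⟨(map_ne_zero _).2 hg.1, fun i x hi => ?_⟩
  have hx : Hom.toSchemeHom ((N : ℤ) • 𝟙 A) (Hom.toSchemeHom ((M : ℤ) • 𝟙 A) x) ∈ E.U i := by
    rwa [← Scheme.Hom.comp_apply, ← toSchemeHom_mul_zsmul_id]
  have h1 := (hg.2 i _ hx).functionFieldMap (f := Hom.toSchemeHom ((M : ℤ) • 𝟙 A))
  rw [map_mul] at h1
  convert h1 using 2
  haveI : IsDominant (Hom.toSchemeHom ((M : ℤ) • 𝟙 A) ≫ Hom.toSchemeHom ((N : ℤ) • 𝟙 A)) :=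
    inferInstance
  rw [functionFieldMap_congr A.toSchemeHom_mul_zsmul_id, functionFieldMap_comp, RingHom.comp_apply]

/-- **Compatibility of the Weil pairings in the level** (Lang, *Abelian Varieties*, VII §2,
Prop. 5: "Suppose that `mna = 0` and `nξ = 0`. Then `e_{mn}(a, ξ) = e_n(ma, ξ)`"; Milne 1986, §16,
Lemma 16.1: "`ē_{mn}(a, a')ⁿ = ē_m(na, na')`"): for `P ∈ A[MN](K)` and `Q ∈ A[N](K)`,
`ē_{MN}^Θ(P, Q) = ē_N^Θ(Pᴹ, Q)`. Printed proof: `[M]^♯ g_Q` trivializes `[MN]^* D_Q`, and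
`t_P^♯ [M]^♯ g_Q / [M]^♯ g_Q = [M]^♯ (t_{Pᴹ}^♯ g_Q / g_Q) = [M]^♯ ē_N(Pᴹ, Q) = ē_N(Pᴹ, Q)`.
[cite: Lang1983AbelianVarieties, Ch. VII §2 Prop. 5] -/
theorem weilPairingLevel_level_mul (Θ : CartierDivisor A.X.left)
    (P : A.torsionPoints K ((M * N : ℕ) : ℤ)) (Q : A.torsionPoints K N) :
    A.weilPairingLevel (N := M * N) Θ P (A.torsionPointsOfDvd M Q) =
      A.weilPairingLevel (N := N) Θ (A.torsionPointsPow M P) Q := by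
  have hh := A.isTrivializer_weilFn (N := N) Θ Q
  have hh' : A.IsTrivializer (n := M * N) (A.weilDiv Θ (A.torsionPointsOfDvd M Q).1)
      (functionFieldMap (Hom.toSchemeHom ((M : ℤ) • 𝟙 A)) (A.weilFn Θ Q)) := hh.level_mul
  rw [weilPairingLevel_eq_kummerConst (N := M * N) (Q := A.torsionPointsOfDvd M Q) hh' P]
  apply (algebraMap K A.X.left.functionField).injective
  have rhs : algebraMap K A.X.left.functionField
      (A.weilPairingLevel (N := N) Θ (A.torsionPointsPow M P) Q) =
        A.translFF (P.1 ^ M) (A.weilFn Θ Q) / A.weilFn Θ Q :=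
    algebraMap_kummerConst hh (A.torsionPointsPow M P)
  rw [algebraMap_kummerConst, ← A.functionFieldMap_toSchemeHom_algebraMap ((M : ℤ) • 𝟙 A), rhs,
    map_div₀, translFF_functionFieldMap_zsmul']

end LevelChange

end AbelianVariety

end Literature.AlgebraicGeometry.Motives
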